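import Mathlib
import Literature.Analysis.Calculus.RadialHardyTwoEdge
import HarnessLib

/-!
# Hardy chains on `[r₁, r₂] ⊂ (0, ∞)`: `∫ (k^{(m)})² / r^{2(ℓ+1−m)} ≤ 4^{ℓ+1−m} ∫ (k^{(ℓ+1)})²`

Analysis/Calculus support file (everything proved). Iterating the weighted interval Hardy inequality
of `RadialHardyTwoEdge.lean` (`hardy_sq_interval_weighted_le`, weight `ζ = r^{−2q}`) for a function
vanishing at the left endpoint gives the single step
`∫_{r₁}^{r₂} Φ²/r^{2q+2} ≤ 4 ∫_{r₁}^{r₂} Φ'²/r^{2q}` (`hardy_sq_div_pow_le`, `Φ(r₁) = 0`, `0 < r₁ ≤ r₂`),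
and, for `k ∈ C^{ℓ+1}` whose derivatives of order `≤ ℓ` vanish at `r₁`, the chain
`∫_{r₁}^{r₂} (k^{(m)})²/r^{2(ℓ+1−m)} ≤ 4^{ℓ+1−m} ∫_{r₁}^{r₂} (k^{(ℓ+1)})²` for every `m ≤ ℓ + 1`
(`hardy_chain_iteratedDeriv_le`). This is the coercivity input ("Hardy modulo Taylor polynomials") of
the exact inverse-square exterior channel estimate for `ψ_tt − ψ_xx + ℓ(ℓ+1)x⁻²ψ = 0` via the
intertwining operators `∂ − k/x` (route PhotonSphereChannels, `FixedModeChannels`, far side,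
stmt-FinalStateConjecture-10048). Constants are not sharp (`4` per step instead of `(2/(2q+1))²`).
Folklore.
-/

noncomputable section

namespace Literature.Analysis.Calculus

open MeasureTheory Set intervalIntegral

/-- **One weighted Hardy step.** For `0 < r₁ ≤ r₂`, `Φ` with continuous derivative `Φ'` on
`[r₁, r₂]` and `Φ(r₁) = 0`: `∫_{r₁}^{r₂} Φ²/r^{2q+2} ≤ 4 ∫_{r₁}^{r₂} Φ'²/r^{2q}`. [folklore] -/
theorem hardy_sq_div_pow_le {Φ Φ' : ℝ → ℝ} {r₁ r₂ : ℝ} (hr₁ : 0 < r₁) (hr : r₁ ≤ r₂)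
    (hΦ : ∀ r ∈ Icc r₁ r₂, HasDerivAt Φ (Φ' r) r) (hΦ'c : ContinuousOn Φ' (Icc r₁ r₂))
    (h0 : Φ r₁ = 0) (q : ℕ) :
    ∫ r in r₁..r₂, Φ r ^ 2 / r ^ (2 * q + 2) ≤ 4 * ∫ r in r₁..r₂, Φ' r ^ 2 / r ^ (2 * q) := by
  have hpos : ∀ r ∈ Icc r₁ r₂, 0 < r := fun r hr' => hr₁.trans_le hr'.1
  -- the weight `ζ = r^{-2q}` and its derivative
  set ζ : ℝ → ℝ := fun r => (r ^ (2 * q))⁻¹ with hζ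
  set ζ' : ℝ → ℝ := fun r => -((2 * q : ℕ) * r ^ (2 * q - 1)) / (r ^ (2 * q)) ^ 2 with hζ'
  have hζd : ∀ r ∈ Icc r₁ r₂, HasDerivAt ζ (ζ' r) r := by
    intro r hr'
    have hr0 : r ^ (2 * q) ≠ 0 := pow_ne_zero _ (hpos r hr').ne'
    have h := (hasDerivAt_pow (2 * q) r).inv hr0
    simp only [hζ, hζ']
    exact h
  have hζ'c : ContinuousOn ζ' (Icc r₁ r₂) := by
    refine ContinuousOn.div (by fun_prop) (by fun_prop) fun r hr' => ?_
    exact pow_ne_zero _ (pow_ne_zero _ (hpos r hr').ne')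
  have hζ0 : ∀ r ∈ Icc r₁ r₂, 0 ≤ ζ r := fun r hr' => by
    simp only [hζ]; exact inv_nonneg.2 (pow_nonneg (hpos r hr').le _)
  have h := hardy_sq_interval_weighted_le hr₁ hr hΦ hζd hΦ'c hζ'c hζ0
  rw [h0] at h
  simp only [zero_pow two_ne_zero, mul_zero, zero_div, zero_add] at h
  -- drop the non-negative layer and outer-edge terms
  have hlayer : 0 ≤ ∫ r in r₁..r₂, (-ζ' r) * Φ r ^ 2 / r := by
    refine intervalIntegral.integral_nonneg hr fun r hr' => ?_
    have hrp : 0 < r := hpos r hr'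
    have hneg : 0 ≤ -ζ' r := by
      simp only [hζ', neg_div, neg_neg]
      positivity
    exact div_nonneg (mul_nonneg hneg (sq_nonneg _)) hrp.le
  have hedge : 0 ≤ ζ r₂ * Φ r₂ ^ 2 / r₂ :=
    div_nonneg (mul_nonneg (hζ0 r₂ ⟨hr, le_rfl⟩) (sq_nonneg _)) (hr₁.le.trans hr)
  have hmain : (∫ r in r₁..r₂, ζ r * Φ r ^ 2 / r ^ 2) ≤ 4 * ∫ r in r₁..r₂, ζ r * Φ' r ^ 2 := by
    linarith
  -- rewrite the weights
  have e1 : (∫ r in r₁..r₂, ζ r * Φ r ^ 2 / r ^ 2) = ∫ r in r₁..r₂, Φ r ^ 2 / r ^ (2 * q + 2) := by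
    refine integral_congr fun r hr' => ?_
    rw [uIcc_of_le hr] at hr'
    have hrp : (r : ℝ) ≠ 0 := (hpos r hr').ne'
    simp only [hζ]
    field_simp
    ring
  have e2 : (∫ r in r₁..r₂, ζ r * Φ' r ^ 2) = ∫ r in r₁..r₂, Φ' r ^ 2 / r ^ (2 * q) := by
    refine integral_congr fun r hr' => ?_
    simp only [hζ]
    ring
  rw [e1, e2] at hmain
  exact hmain

/-- **Hardy chain.** For `0 < r₁ ≤ r₂`, `k ∈ C^{ℓ+1}(ℝ)` with `k^{(j)}(r₁) = 0` for all `j ≤ ℓ`, and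
`p ≤ ℓ + 1`: `∫_{r₁}^{r₂} (k^{(ℓ+1−p)})² / r^{2p} ≤ 4^p ∫_{r₁}^{r₂} (k^{(ℓ+1)})²`. [folklore] -/
theorem hardy_chain_iteratedDeriv_le {k : ℝ → ℝ} {ℓ : ℕ} (hk : ContDiff ℝ (ℓ + 1) k) {r₁ r₂ : ℝ}
    (hr₁ : 0 < r₁) (hr : r₁ ≤ r₂) (hvan : ∀ j ≤ ℓ, iteratedDeriv j k r₁ = 0) {p : ℕ}
    (hp : p ≤ ℓ + 1) :
    ∫ r in r₁..r₂, iteratedDeriv (ℓ + 1 - p) k r ^ 2 / r ^ (2 * p)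
      ≤ 4 ^ p * ∫ r in r₁..r₂, iteratedDeriv (ℓ + 1) k r ^ 2 := by
  induction p with
  | zero => simp
  | succ p ih =>
    have hp' : p ≤ ℓ + 1 := Nat.le_of_succ_le hp
    set m : ℕ := ℓ + 1 - (p + 1) with hm
    have hmℓ : m ≤ ℓ := by omega
    have hm1 : m + 1 = ℓ + 1 - p := by omega
    -- `Φ = k^{(m)}`, `Φ' = k^{(m+1)}`
    have hdiff : Differentiable ℝ (iteratedDeriv m k) :=
      hk.differentiable_iteratedDeriv m (by exact_mod_cast Nat.lt_succ_of_le hmℓ)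
    have hcont : Continuous (iteratedDeriv (m + 1) k) :=
      hk.continuous_iteratedDeriv (m + 1) (by exact_mod_cast Nat.succ_le_succ hmℓ)
    have hΦ : ∀ r ∈ Icc r₁ r₂, HasDerivAt (iteratedDeriv m k) (iteratedDeriv (m + 1) k r) r := by
      intro r _
      rw [iteratedDeriv_succ]
      exact (hdiff r).hasDerivAt
    have hstep := hardy_sq_div_pow_le hr₁ hr hΦ hcont.continuousOn (hvan m hmℓ) p
    rw [show 2 * p + 2 = 2 * (p + 1) by ring] at hstep
    rw [hm1] at hstep
    calc (∫ r in r₁..r₂, iteratedDeriv m k r ^ 2 / r ^ (2 * (p + 1)))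
        ≤ 4 * ∫ r in r₁..r₂, iteratedDeriv (ℓ + 1 - p) k r ^ 2 / r ^ (2 * p) := hstep
      _ ≤ 4 * (4 ^ p * ∫ r in r₁..r₂, iteratedDeriv (ℓ + 1) k r ^ 2) :=
          mul_le_mul_of_nonneg_left (ih hp') (by norm_num)
      _ = 4 ^ (p + 1) * ∫ r in r₁..r₂, iteratedDeriv (ℓ + 1) k r ^ 2 := by ring

/-- **Hardy chain, `m`-form**: under the same hypotheses, for `m ≤ ℓ + 1`,
`∫_{r₁}^{r₂} (k^{(m)})²/r^{2(ℓ+1−m)} ≤ 4^{ℓ+1−m} ∫_{r₁}^{r₂} (k^{(ℓ+1)})²`. [folklore] -/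
theorem hardy_chain_iteratedDeriv_le' {k : ℝ → ℝ} {ℓ : ℕ} (hk : ContDiff ℝ (ℓ + 1) k) {r₁ r₂ : ℝ}
    (hr₁ : 0 < r₁) (hr : r₁ ≤ r₂) (hvan : ∀ j ≤ ℓ, iteratedDeriv j k r₁ = 0) {m : ℕ}
    (hm : m ≤ ℓ + 1) :
    ∫ r in r₁..r₂, iteratedDeriv m k r ^ 2 / r ^ (2 * (ℓ + 1 - m))
      ≤ 4 ^ (ℓ + 1 - m) * ∫ r in r₁..r₂, iteratedDeriv (ℓ + 1) k r ^ 2 := by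
  have h := hardy_chain_iteratedDeriv_le hk hr₁ hr hvan (p := ℓ + 1 - m) (by omega)
  rwa [show ℓ + 1 - (ℓ + 1 - m) = m by omega] at h

end Literature.Analysis.Calculus
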